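import Summits.CriticalPhenomena.SAWScalingLimit.Theorems.ConfinementPositivity.Negative.SocketsFalse

/-!
# `ConfinementPositivity` (stmt-CriticalPhenomena-17587) — negative knowledge, cusp series part 7: agreement of the first marked points is load-bearing

Refuter crux-attack support file (cdisprove) for the crux
`Summit.CriticalPhenomena.SAWScalingLimit.Theses.SAWRenewalTightness.ConfinementPositivity`.

* `false_without_samePt0` — deleting the hypothesis `D'.pt 0 = D.pt 0` from the crux (all
  other hypotheses verbatim: `0 < d`, nesting, `D'.pt 1 = D.pt 1`, the SOCKETS around the marked
  points OF `D`, an honest endpoint approximation of `D'`) makes it FALSE.  Witness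
  (`exists_cuspPair_offMark`): the same cusp pair as in `SocketsFalse`
  (`D' = {0<x<1, |y|<x²/16} ⊆ D = {0<x<1, -1<y<x²/16}`, `b = 1` common), but with the first
  marked point of `D` moved to `p = 1/2 + i/64` on the COMMON upper boundary arc, where the
  sockets hold (`d = 1/128`), while `D'` is marked at its cusp tip `0`, towards which the
  approximation `a_δ = (1, 0)` converges.  The corridor/detour computation of parts 3–5 is
  unchanged: `c (4k-1) x_c⁴ ≤ 1` for all large `k`, absurd.

Moral for provers: the sockets must sit at the points the APPROXIMATION converges to; the
hypothesis `D'.pt 0 = D.pt 0` is what ties the two together (symmetrically for `pt 1`).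
Written on the VERBATIM body of the crux with one hypothesis deleted; no positive Theses
conclusion. Everything proved, standard axioms. [folklore]
-/

noncomputable section

namespace Summit.CriticalPhenomena.SAWScalingLimit.Theorems.ConfinementPositivity.Negative

open Set Metric Filter Topology Complex MeasureTheory
open scoped ENNReal
open Literature.Probability.RandomPlanarGeometry Literature.Probability.LatticeModels
open Summit.CriticalPhenomena.SAWScalingLimit.Theorems

/-- The point `q = 1/2 + i/8` of the upper edge is a frontier point of the quadrilateral
`W = {0 < x < 1, -1 < y < x/4}`. [folklore] -/
theorem upper_mem_frontier_quad :
    (⟨1 / 2, 1 / 8⟩ : ℂ) ∈ frontier {z : ℂ | 0 < z.re ∧ z.re < 1 ∧ -1 < z.im ∧ z.im < z.re / 4} := by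
  rw [isOpen_quad.frontier_eq]
  refine ⟨?_, by norm_num⟩
  rw [Metric.mem_closure_iff]
  intro ε hε
  have hmpos : 0 < min (ε / 2) (1 / 2 : ℝ) := by positivity
  refine ⟨⟨1 / 2, 1 / 8 - min (ε / 2) (1 / 2)⟩, ⟨by norm_num, by norm_num, ?_, ?_⟩, ?_⟩
  · show (-1 : ℝ) < 1 / 8 - min (ε / 2) (1 / 2)
    have := min_le_right (ε / 2) (1 / 2 : ℝ); linarith
  · show (1 / 8 - min (ε / 2) (1 / 2) : ℝ) < 1 / 2 / 4
    linarith
  · rw [Complex.dist_of_re_eq (by simp), Real.dist_eq]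
    show |(1 / 8 : ℝ) - (1 / 8 - min (ε / 2) (1 / 2))| < ε
    rw [show (1 / 8 : ℝ) - (1 / 8 - min (ε / 2) (1 / 2)) = min (ε / 2) (1 / 2) by ring,
      abs_of_pos hmpos]
    exact (min_le_left _ _).trans_lt (by linarith)

/-- **The cusp pair, `D` marked off the cusp.**  Dobrushin domains `D' ⊆ D` with the carriers
of `exists_cuspPair`, `D'` marked at `0` and `1`, `D` marked at `p = 1/2 + i/64` (on the common
upper boundary arc `y = x²/16`) and `1`; the sockets of radius `1/128` around BOTH marked points
of `D` lie in `D'`. [folklore] -/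
theorem exists_cuspPair_offMark : ∃ D D' : DobrushinDomain,
    (∀ z : ℂ, z ∈ D'.carrier ↔ 0 < z.re ∧ z.re < 1 ∧ -(z.re ^ 2 / 16) < z.im ∧ z.im < z.re ^ 2 / 16) ∧
    (∀ z : ℂ, z ∈ D.carrier ↔ 0 < z.re ∧ z.re < 1 ∧ -1 < z.im ∧ z.im < z.re ^ 2 / 16) ∧
    D'.carrier ⊆ D.carrier ∧ D'.pt 1 = D.pt 1 ∧ D'.pt 0 = 0 ∧ D'.pt 1 = 1 ∧
    D.carrier ∩ (Metric.ball (D.pt 0) (1 / 128) ∪ Metric.ball (D.pt 1) (1 / 128)) ⊆ D'.carrier := by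
  -- `D'` from the landed pair; `D` rebuilt with the new first mark
  obtain ⟨-, D', hD', -, -, -, -, h0', h1'⟩ := exists_cuspPair
  obtain ⟨⟨-, h1w⟩, ⟨-, h1q⟩⟩ := zero_one_mem_frontier
  have hq1 : (⟨1 / 2, 1 / 8⟩ : ℂ) ≠ 1 := fun h => by
    have := congrArg Complex.re h; norm_num at this
  obtain ⟨E, hEc, hE0, hE1⟩ := exists_dobrushinDomain_of_convex isOpen_quad convex_quad
    ((isBounded_ball (x := (0 : ℂ)) (r := 2)).subset quad_subset_ball)
    ⟨_, wedge_subset_quad (ofReal_mem_wedge (by norm_num : (0 : ℝ) < 1 / 2) (by norm_num))⟩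
    upper_mem_frontier_quad h1q hq1
  obtain ⟨ψ, hψ⟩ := exists_cuspHomeomorph
  have hψ1 : ψ 1 = 1 := Complex.ext (by simp [(hψ 1).1]) (by simp [(hψ 1).2])
  have hψq : ψ ⟨1 / 2, 1 / 8⟩ = ⟨1 / 2, 1 / 64⟩ :=
    Complex.ext (by simp [(hψ _).1]) (by rw [(hψ _).2]; norm_num [abs_of_pos])
  have key₂ : ∀ (y : ℝ), (-1 < y ↔ -1 < y * |y|) := by
    intro y
    rcases le_or_gt 0 y with hy | hy
    · rw [abs_of_nonneg hy]; constructor <;> intro <;> nlinarith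
    · rw [abs_of_neg hy]; constructor <;> intro <;> nlinarith
  have key₃ : ∀ (y x : ℝ), 0 < x → (y < x / 4 ↔ y * |y| < x ^ 2 / 16) := by
    intro y x hx
    rcases le_or_gt 0 y with hy | hy
    · rw [abs_of_nonneg hy]; constructor <;> intro <;> nlinarith
    · rw [abs_of_neg hy]; constructor <;> intro <;> nlinarith
  have hD : ∀ z : ℂ, z ∈ (E.map ψ).carrier ↔ 0 < z.re ∧ z.re < 1 ∧ -1 < z.im ∧ z.im < z.re ^ 2 / 16 := by
    intro z
    rw [MarkedDomain.carrier_map, hEc, ← ψ.apply_symm_apply z, ψ.injective.mem_set_image]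
    set w := ψ.symm z
    simp only [mem_setOf_eq, (hψ w).1, (hψ w).2]
    constructor
    · rintro ⟨h1, h2, h3, h4⟩
      exact ⟨h1, h2, (key₂ w.im).1 h3, (key₃ w.im w.re h1).1 h4⟩
    · rintro ⟨h1, h2, h3, h4⟩
      exact ⟨h1, h2, (key₂ w.im).2 h3, (key₃ w.im w.re h1).2 h4⟩
  have hDpt0 : (E.map ψ).pt 0 = ⟨1 / 2, 1 / 64⟩ := by rw [MarkedDomain.pt_map, hE0, hψq]
  have hDpt1 : (E.map ψ).pt 1 = 1 := by rw [MarkedDomain.pt_map, hE1, hψ1]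
  refine ⟨E.map ψ, D', hD', hD, ?_, ?_, h0', h1', ?_⟩
  · intro z hz
    rw [hD' z] at hz
    rw [hD z]
    obtain ⟨h1, h2, h3, h4⟩ := hz
    have : z.re ^ 2 < 1 := by nlinarith
    exact ⟨h1, h2, by linarith, h4⟩
  · rw [h1', hDpt1]
  · -- the sockets of radius `1/128` around `p` and `1`
    rintro z ⟨hzD, hz⟩
    rw [hD z] at hzD
    rw [hD' z]
    obtain ⟨h1, h2, h3, h4⟩ := hzD
    refine ⟨h1, h2, ?_, h4⟩
    have hsq : 0 ≤ z.re ^ 2 := sq_nonneg _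
    rcases hz with hz | hz
    · rw [hDpt0, Metric.mem_ball, Complex.dist_eq] at hz
      have him : |z.im - 1 / 64| < 1 / 128 := by
        have := Complex.abs_im_le_norm (z - ⟨1 / 2, 1 / 64⟩)
        simp only [Complex.sub_im] at this
        linarith
      have := (abs_lt.1 him).1
      nlinarith
    · rw [hDpt1, Metric.mem_ball, Complex.dist_eq] at hz
      have him : |z.im| < 1 / 128 := by
        have := Complex.abs_im_le_norm (z - 1)
        simp only [Complex.sub_im, Complex.one_im, sub_zero] at this
        linarith
      have hre : |z.re - 1| < 1 / 128 := by
        have := Complex.abs_re_le_norm (z - 1)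
        simp only [Complex.sub_re, Complex.one_re] at this
        linarith
      have h5 := (abs_lt.1 him).1
      have h6 := (abs_lt.1 hre).1
      nlinarith

/-- **`D'.pt 0 = D.pt 0` is load-bearing.** The crux WITHOUT the hypothesis `D'.pt 0 = D.pt 0`
is FALSE (cusp witness with `D` marked off the cusp tip, sockets intact; see the module
docstring). [folklore] -/
theorem false_without_samePt0 :
    ¬ ∀ (D D' : DobrushinDomain) (a b : ℝ → Site 2) (d : ℝ), 0 < d → D'.carrier ⊆ D.carrier →
      D'.pt 1 = D.pt 1 →
      D.carrier ∩ (Metric.ball (D.pt 0) d ∪ Metric.ball (D.pt 1) d) ⊆ D'.carrier →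
      SAW.IsEndpointApprox D' a b →
      ∃ c δ₀ : ℝ, 0 < c ∧ 0 < δ₀ ∧ ∀ δ ∈ Set.Ioc (0 : ℝ) δ₀,
        ENNReal.ofReal c ≤ SAW.law D.carrier δ (a δ) (b δ)
          {γ | ∃ γ' : SAW.DomainSAW D'.carrier δ (a δ) (b δ), γ'.walk.support = γ.walk.support} := by
  intro h
  obtain ⟨D, D', hD', hD, hsub, h1, h0', h1', hsock⟩ := exists_cuspPair_offMark
  have hab : SAW.IsEndpointApprox D' (fun _ => ![1, 0]) (fun δ => ![⌈δ⁻¹⌉ - 1, 0]) :=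
    strip_isEndpointApprox (lo := fun x : ℝ => -(x ^ 2 / 16)) (hi := fun x : ℝ => x ^ 2 / 16)
      hD' cusp_sign monotoneOn_sq_div antitoneOn_neg_sq_div h0' h1'
  obtain ⟨c, δ₀, hc, hδ₀, hall⟩ :=
    h D D' (fun _ => ![1, 0]) (fun δ => ![⌈δ⁻¹⌉ - 1, 0]) (1 / 128) (by norm_num) hsub h1 hsock hab
  have hxc : 0 < SAW.criticalFugacity := SAW.criticalFugacity_pos
  obtain ⟨k, hk5, hkδ, hkt⟩ := exists_scale hδ₀ (mul_pos hc (pow_pos hxc 4))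
  set δ : ℝ := ((k : ℝ) ^ 2)⁻¹ with hδdef
  have hk1 : 1 ≤ k := by omega
  have hkR : (5 : ℝ) ≤ k := by exact_mod_cast hk5
  have hδpos : 0 < δ := by positivity
  have hδ1 : δ < 1 := by
    rw [hδdef]; apply inv_lt_one_of_one_lt₀; nlinarith
  have hceil : ⌈δ⁻¹⌉ = (k : ℤ) ^ 2 := by
    rw [hδdef, inv_inv]
    have : ((k : ℝ) ^ 2) = (((k : ℤ) ^ 2 : ℤ) : ℝ) := by norm_cast
    rw [this, Int.ceil_intCast]
  set B : ℤ := ⌈δ⁻¹⌉ - 1 with hBdef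
  have hB : 4 * (k : ℤ) + 1 ≤ B := by
    rw [hBdef, hceil]
    have : (5 : ℤ) ≤ k := by exact_mod_cast hk5
    nlinarith
  have hmain := hall δ ⟨hδpos, hkδ⟩
  beta_reduce at hmain
  have hratio := ratio_of_law_ge hc hmain
  have hdet := fat_weight_ge hD' hD hk5 hB
  change ((4 * k - 1 : ℕ) : ℝ≥0∞) * ENNReal.ofReal (SAW.criticalFugacity ^ 4) *
      SAW.weight D'.carrier δ ![1, 0] ![B, 0] Set.univ ≤
    SAW.weight D.carrier δ ![1, 0] ![B, 0] Set.univ at hdet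
  set Z := SAW.weight D.carrier δ ![1, 0] ![B, 0] Set.univ with hZdef
  set Z' := SAW.weight D'.carrier δ ![1, 0] ![B, 0] Set.univ with hZ'def
  have hbB := stdA_bounds hδpos hδ1
  have hreach : (discreteDomainGraph D'.carrier δ).Reachable ![1, 0] ![B, 0] :=
    strip_dd_reachable (lo := fun x : ℝ => -(x ^ 2 / 16)) (hi := fun x : ℝ => x ^ 2 / 16) hD'
      cusp_sign monotoneOn_sq_div antitoneOn_neg_sq_div hδpos hδ1
      (strip_one_mem (lo := fun x : ℝ => -(x ^ 2 / 16)) (hi := fun x : ℝ => x ^ 2 / 16) hD'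
        cusp_sign hδpos hδ1)
      (strip_axis_mem (lo := fun x : ℝ => -(x ^ 2 / 16)) (hi := fun x : ℝ => x ^ 2 / 16) hD'
        cusp_sign hbB.1 hbB.2)
  have hZ'0 : Z' ≠ 0 := ConfinementAudit.weight_univ_ne_zero hreach
  have hZ'top : Z' ≠ ⊤ := ConfinementAudit.weight_univ_ne_top D'.isBounded hδpos
  have hchain : ENNReal.ofReal c * ((4 * k - 1 : ℕ) : ℝ≥0∞) *
      ENNReal.ofReal (SAW.criticalFugacity ^ 4) * Z' ≤ 1 * Z' := by
    rw [one_mul]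
    calc ENNReal.ofReal c * ((4 * k - 1 : ℕ) : ℝ≥0∞) * ENNReal.ofReal (SAW.criticalFugacity ^ 4) * Z'
        = ENNReal.ofReal c * (((4 * k - 1 : ℕ) : ℝ≥0∞) *
            ENNReal.ofReal (SAW.criticalFugacity ^ 4) * Z') := by ring
      _ ≤ ENNReal.ofReal c * Z := mul_le_mul' le_rfl hdet
      _ ≤ Z' := hratio
  have h2 : ENNReal.ofReal c * ((4 * k - 1 : ℕ) : ℝ≥0∞) *
      ENNReal.ofReal (SAW.criticalFugacity ^ 4) ≤ 1 :=
    (ENNReal.mul_le_mul_iff_left hZ'0 hZ'top).1 hchain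
  have h3 : ENNReal.ofReal (c * ((4 * k - 1 : ℕ) : ℝ) * SAW.criticalFugacity ^ 4) ≤ 1 := by
    rwa [ENNReal.ofReal_mul (by positivity), ENNReal.ofReal_mul hc.le, ENNReal.ofReal_natCast]
  have h4 : c * ((4 * k - 1 : ℕ) : ℝ) * SAW.criticalFugacity ^ 4 ≤ 1 := ENNReal.ofReal_le_one.1 h3
  have : c * ((4 * k - 1 : ℕ) : ℝ) * SAW.criticalFugacity ^ 4 =
      ((4 * k - 1 : ℕ) : ℝ) * (c * SAW.criticalFugacity ^ 4) := by ring
  rw [this] at h4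
  linarith

end Summit.CriticalPhenomena.SAWScalingLimit.Theorems.ConfinementPositivity.Negative

end
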